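import Mathlib.GroupTheory.SpecificGroups.Quaternion
import Summits.MatrixMultiplication.OmegaCensus.BoxNotUsefulLift
import Summits.MatrixMultiplication.OmegaCensus.IndepLiftSubgroup

/-!
# ω-census, family (b3): conjecture C9 — box-uselessness lifts along EMBEDDINGS too; the BAD groups `D₂₂, D₂₄, D₂₆, Dic₆` in the kernel

HONEST FRAMING (pub-omega census; verbatim): lottery ticket; floor = certified bounds/negative ranges.
Census BOOKKEEPING (conjecture C9 of the cell — the '(a)-FORCED by a BAD section' mechanism of prereg P-035 —; pub-omega
stpp-1 gen 18, continuing gen 17's `BoxNotUsefulLift` / `BoxBadSmallGroups`):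
* `not_boxUseful_of_injective` — the SUBGROUP half in the same shape as `not_boxUseful_of_surjective`: if a group `Q` that
  EMBEDS in `G` (`f : Q →* G` injective) has a `3 × 3` box with an independent cell set of at least `(9/5)|Q|` cells, then
  `G` is not box-useful (transport along `Q ≃* f.range`, then `DihC3Sq.exists_indep_lift_subgroup`: `#J = #I·[G : f.range]`).
  With it a P-035 row forced by a BAD SUBGROUP (60 of the 64 forced rows) reads 'r ≥ 9/5, KERNEL' once the embedding is
  exhibited, exactly as a row forced by a bad quotient does through `not_boxUseful_of_surjective`.
* Four more minimal BAD groups of order `≤ 31` as Mathlib types: `DihedralGroup 11 / 12 / 13` (`D₂₂`, `D₂₄`, `D₂₆`) and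
  `QuaternionGroup 6` (`Dic₆`, order `24`), each with an explicit independent cell set of `42 / 44 / 50 / 44` cells
  (`≥ (9/5)|G|`; the cell's exact values of record are `42, 44, ≥ 50, 44`, Pb67 / P-028.5, kit j230106) in the box
  `Y = {1, r, s}`, `W = {1, r², s}`: the Pb67 witnesses (cell tables `D22/D24/D26/Dic6.tab`) transported to Mathlib's
  coordinates along an explicitly computed isomorphism (stpp-1 g18 `code/bad/transfer.py`, re-verified on both tables) and
  CHECKED HERE by `decide`; hence `¬ BoxUseful` for each, for every finite group mapping ONTO one of them, and for every finite
  group CONTAINING one of them.  (`D₂₄`, `Dic₆` and `C₃ ⋊ D₈` are the three groups of order `24` with `α = 44 = (9/5)·24 + 0.8`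
  — the witness IS an optimal box.)
Nothing here is progress on `ω`.
-/

namespace Summit.MatrixMultiplication.OmegaCensus

open Finset ProductBoxBound

variable {G : Type*} [Group G] [Fintype G] [DecidableEq G]

/-- **Box-uselessness lifts along embeddings** (subgroup half of C9 (a), witness form). If `f : Q →* G` is injective and `Q`
has a `3 × 3` box with an independent cell set `I`, `9|Q| ≤ 5|I|`, then `G` is not box-useful: transport `I` into the subgroup
`f.range ≃* Q` and lift it with `DihC3Sq.exists_indep_lift_subgroup` to `#I · [G : f.range]` independent cells of a `3 × 3`
box of `G`. [folklore] -/
theorem not_boxUseful_of_injective {Q : Type*} [Group Q] [Fintype Q] [DecidableEq Q] (f : Q →* G)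
    (hf : Function.Injective f) {Y W : Finset Q} (hY : #Y = 3) (hW : #W = 3) {I : Finset (Q × Q × Q)}
    (hI : I ⊆ univ ×ˢ (Y ×ˢ W)) (hind : ∀ P ∈ I, ∀ P' ∈ I, P ≠ P' → cellWord P P' ≠ 1)
    (hbig : 9 * Fintype.card Q ≤ 5 * #I) : ¬ BoxUseful G := by
  classical
  set H : Subgroup G := f.range with hH
  let e : Q ≃* ↥H := MonoidHom.ofInjective hf
  let em : Q ↪ ↥H := e.toEquiv.toEmbedding
  let em3 : Q × Q × Q ↪ ↥H × ↥H × ↥H :=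
    ⟨fun c => (e c.1, e c.2.1, e c.2.2), fun c c' h => by
      simp only [Prod.mk.injEq, EmbeddingLike.apply_eq_iff_eq] at h
      exact Prod.ext h.1 (Prod.ext h.2.1 h.2.2)⟩
  have em3_apply : ∀ c : Q × Q × Q, em3 c = (e c.1, e c.2.1, e c.2.2) := fun c => rfl
  have em_apply : ∀ q : Q, em q = e q := fun q => rfl
  have hI' : I.map em3 ⊆ univ ×ˢ (Y.map em ×ˢ W.map em) := by
    intro P hP
    obtain ⟨c, hc, rfl⟩ := mem_map.1 hP
    have hc2 := hI hc
    simp only [mem_product, mem_univ, true_and] at hc2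
    simp only [em3_apply, mem_product, mem_univ, true_and, mem_map, em_apply]
    exact ⟨⟨c.2.1, hc2.1, rfl⟩, ⟨c.2.2, hc2.2, rfl⟩⟩
  have hind' : ∀ P ∈ I.map em3, ∀ P' ∈ I.map em3, P ≠ P' → DihC3Sq.E2 P P' ≠ 1 := by
    intro P hP P' hP' hne h1
    obtain ⟨c, hc, rfl⟩ := mem_map.1 hP
    obtain ⟨c', hc', rfl⟩ := mem_map.1 hP'
    have hcc : c ≠ c' := fun h => hne (by rw [h])
    have hE : DihC3Sq.E2 (em3 c) (em3 c') = e (cellWord c c') := by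
      simp only [em3_apply, DihC3Sq.E2, cellWord, map_mul, map_inv]
    rw [hE, map_eq_one_iff e e.injective] at h1
    exact hind c hc c' hc' hcc h1
  obtain ⟨Y', W', J, hY', hW', hJ, hJind, hJcard⟩ := DihC3Sq.exists_indep_lift_subgroup H hI' hind'
  refine not_boxUseful_of_indep (G := G) (by rw [hY', card_map, hY]) (by rw [hW', card_map, hW]) hJ hJind ?_
  rw [card_map] at hJcard
  have hHQ : Nat.card ↥H = Fintype.card Q := by
    rw [← Nat.card_congr e.toEquiv, Nat.card_eq_fintype_card]
  have hG : Fintype.card G = Fintype.card Q * H.index := by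
    rw [← Nat.card_eq_fintype_card (α := G), ← Subgroup.card_mul_index H, hHQ]
  rw [hG, hJcard]
  calc 9 * (Fintype.card Q * H.index) = 9 * Fintype.card Q * H.index := by ring
    _ ≤ 5 * #I * H.index := Nat.mul_le_mul_right _ hbig
    _ = 5 * (#I * H.index) := by ring

/-- **No finite group containing `D₁₀` is box-useful** (the subgroup form of `not_boxUseful_of_surjective_dihedral5`,
`BoxNotUsefulLift`). [folklore] -/
theorem not_boxUseful_of_injective_dihedral5 (f : DihedralGroup 5 →* G) (hf : Function.Injective f) : ¬ BoxUseful G := by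
  obtain ⟨Y, W, I, hY, hW, hI, hind, hcard⟩ := D5_exists_indep_18
  exact not_boxUseful_of_injective f hf hY hW hI hind (by rw [hcard, DihedralGroup.card])

/-! ### `DihedralGroup 11` (`D₂₂`, order `22`): `42` independent cells `≥ (9/5)·22` -/

/-- The transported Pb67 witness of `DihedralGroup 11`: `42` cells of the box `Y = {.r 0, .r 1, .sr 0}`, `W = {.r 0, .r 2, .sr 0}` (as a list). [folklore] -/
def dihedral11WitnessL : List (DihedralGroup 11 × DihedralGroup 11 × DihedralGroup 11) :=
  [(.r 0, .r 0, .r 0), (.r 0, .r 1, .r 2), (.r 0, .r 1, .sr 0), (.r 0, .sr 0, .r 2), (.r 1, .r 1, .r 0),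
    (.r 2, .r 0, .r 2), (.r 3, .r 1, .r 2), (.r 3, .sr 0, .r 2), (.r 4, .r 0, .sr 0), (.r 4, .r 1, .r 0),
    (.r 5, .r 0, .r 2), (.r 5, .r 1, .sr 0), (.r 6, .r 1, .r 2), (.r 6, .sr 0, .sr 0), (.r 7, .r 0, .sr 0),
    (.r 8, .r 0, .r 0), (.r 8, .r 1, .sr 0), (.r 8, .sr 0, .r 2), (.r 9, .r 1, .r 0), (.r 9, .sr 0, .sr 0),
    (.r 10, .r 0, .r 2), (.sr 0, .r 0, .r 0), (.sr 0, .r 1, .r 2), (.sr 0, .r 1, .sr 0), (.sr 0, .sr 0, .r 2),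
    (.sr 1, .r 0, .r 2), (.sr 2, .r 1, .r 0), (.sr 2, .sr 0, .sr 0), (.sr 3, .r 0, .r 0), (.sr 3, .r 1, .sr 0),
    (.sr 3, .sr 0, .r 2), (.sr 4, .r 0, .sr 0), (.sr 5, .r 1, .r 2), (.sr 5, .sr 0, .sr 0), (.sr 6, .r 0, .r 2),
    (.sr 6, .r 1, .sr 0), (.sr 7, .r 0, .sr 0), (.sr 7, .r 1, .r 0), (.sr 8, .r 1, .r 2), (.sr 8, .sr 0, .r 2),
    (.sr 9, .r 0, .r 2), (.sr 10, .r 1, .r 0)]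

set_option maxHeartbeats 4000000 in
/-- **`α(D₂₂; 22, 3, 3) ≥ 42`** (kernel-checked witness; `5·42 ≥ 9·22`). [folklore] -/
theorem dihedral11_exists_indep :
    ∃ (Y W : Finset (DihedralGroup 11)) (I : Finset (DihedralGroup 11 × DihedralGroup 11 × DihedralGroup 11)),
      #Y = 3 ∧ #W = 3 ∧ I ⊆ univ ×ˢ (Y ×ˢ W) ∧ (∀ P ∈ I, ∀ P' ∈ I, P ≠ P' → cellWord P P' ≠ 1) ∧ #I = 42 :=
  ⟨{.r 0, .r 1, .sr 0}, {.r 0, .r 2, .sr 0}, dihedral11WitnessL.toFinset, by decide +kernel, by decide +kernel,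
    DihC3Sq.subset_box_of_inBoxB (by decide +kernel), DihC3Sq.indep_of_indepB (by decide +kernel), by decide +kernel⟩

/-- **No finite group mapping onto `D₂₂` is box-useful.** [folklore] -/
theorem not_boxUseful_of_surjective_dihedral11 (f : G →* DihedralGroup 11) (hf : Function.Surjective f) : ¬ BoxUseful G := by
  obtain ⟨Y, W, I, hY, hW, hI, hind, hcard⟩ := dihedral11_exists_indep
  exact not_boxUseful_of_surjective f hf hY hW hI hind (by rw [hcard, DihedralGroup.card]; omega)

/-- **No finite group containing `D₂₂` is box-useful.** [folklore] -/
theorem not_boxUseful_of_injective_dihedral11 (f : DihedralGroup 11 →* G) (hf : Function.Injective f) : ¬ BoxUseful G := by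
  obtain ⟨Y, W, I, hY, hW, hI, hind, hcard⟩ := dihedral11_exists_indep
  exact not_boxUseful_of_injective f hf hY hW hI hind (by rw [hcard, DihedralGroup.card]; omega)

/-- **`D₂₂` is not box-useful.** [folklore] -/
theorem not_boxUseful_dihedral11 : ¬ BoxUseful (DihedralGroup 11) :=
  not_boxUseful_of_surjective_dihedral11 (MonoidHom.id _) Function.surjective_id

/-! ### `DihedralGroup 12` (`D₂₄`, order `24`): `44` independent cells `≥ (9/5)·24` -/

/-- The transported Pb67 witness of `DihedralGroup 12`: `44` cells of the box `Y = {.r 0, .r 1, .sr 0}`, `W = {.r 0, .r 2, .sr 0}` (as a list). [folklore] -/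
def dihedral12WitnessL : List (DihedralGroup 12 × DihedralGroup 12 × DihedralGroup 12) :=
  [(.r 0, .r 0, .r 0), (.r 0, .r 1, .sr 0), (.r 0, .sr 0, .r 2), (.r 1, .r 1, .r 0), (.r 2, .r 0, .r 2),
    (.r 3, .r 0, .sr 0), (.r 3, .r 1, .r 2), (.r 3, .sr 0, .sr 0), (.r 4, .r 0, .sr 0), (.r 4, .r 1, .sr 0),
    (.r 5, .r 0, .r 0), (.r 5, .r 1, .sr 0), (.r 6, .r 1, .r 0), (.r 6, .sr 0, .sr 0), (.r 7, .r 0, .r 2),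
    (.r 7, .sr 0, .r 2), (.r 8, .r 0, .sr 0), (.r 8, .r 1, .r 2), (.r 9, .r 1, .sr 0), (.r 10, .sr 0, .sr 0),
    (.r 11, .r 0, .sr 0), (.r 11, .sr 0, .sr 0), (.sr 0, .r 0, .r 0), (.sr 0, .r 1, .sr 0), (.sr 0, .sr 0, .r 2),
    (.sr 1, .r 0, .sr 0), (.sr 1, .sr 0, .sr 0), (.sr 2, .sr 0, .sr 0), (.sr 3, .r 1, .sr 0), (.sr 4, .r 0, .sr 0),
    (.sr 4, .r 1, .r 2), (.sr 5, .r 0, .r 2), (.sr 5, .sr 0, .r 2), (.sr 6, .r 1, .r 0), (.sr 6, .sr 0, .sr 0),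
    (.sr 7, .r 0, .r 0), (.sr 7, .r 1, .sr 0), (.sr 8, .r 0, .sr 0), (.sr 8, .r 1, .sr 0), (.sr 9, .r 0, .sr 0),
    (.sr 9, .r 1, .r 2), (.sr 9, .sr 0, .sr 0), (.sr 10, .r 0, .r 2), (.sr 11, .r 1, .r 0)]

set_option maxHeartbeats 4000000 in
/-- **`α(D₂₄; 24, 3, 3) ≥ 44`** (kernel-checked witness; `5·44 ≥ 9·24`). [folklore] -/
theorem dihedral12_exists_indep :
    ∃ (Y W : Finset (DihedralGroup 12)) (I : Finset (DihedralGroup 12 × DihedralGroup 12 × DihedralGroup 12)),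
      #Y = 3 ∧ #W = 3 ∧ I ⊆ univ ×ˢ (Y ×ˢ W) ∧ (∀ P ∈ I, ∀ P' ∈ I, P ≠ P' → cellWord P P' ≠ 1) ∧ #I = 44 :=
  ⟨{.r 0, .r 1, .sr 0}, {.r 0, .r 2, .sr 0}, dihedral12WitnessL.toFinset, by decide +kernel, by decide +kernel,
    DihC3Sq.subset_box_of_inBoxB (by decide +kernel), DihC3Sq.indep_of_indepB (by decide +kernel), by decide +kernel⟩

/-- **No finite group mapping onto `D₂₄` is box-useful.** [folklore] -/
theorem not_boxUseful_of_surjective_dihedral12 (f : G →* DihedralGroup 12) (hf : Function.Surjective f) : ¬ BoxUseful G := by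
  obtain ⟨Y, W, I, hY, hW, hI, hind, hcard⟩ := dihedral12_exists_indep
  exact not_boxUseful_of_surjective f hf hY hW hI hind (by rw [hcard, DihedralGroup.card]; omega)

/-- **No finite group containing `D₂₄` is box-useful.** [folklore] -/
theorem not_boxUseful_of_injective_dihedral12 (f : DihedralGroup 12 →* G) (hf : Function.Injective f) : ¬ BoxUseful G := by
  obtain ⟨Y, W, I, hY, hW, hI, hind, hcard⟩ := dihedral12_exists_indep
  exact not_boxUseful_of_injective f hf hY hW hI hind (by rw [hcard, DihedralGroup.card]; omega)

/-- **`D₂₄` is not box-useful.** [folklore] -/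
theorem not_boxUseful_dihedral12 : ¬ BoxUseful (DihedralGroup 12) :=
  not_boxUseful_of_surjective_dihedral12 (MonoidHom.id _) Function.surjective_id

/-! ### `DihedralGroup 13` (`D₂₆`, order `26`): `50` independent cells `≥ (9/5)·26` -/

/-- The transported Pb67 witness of `DihedralGroup 13`: `50` cells of the box `Y = {.r 0, .r 1, .sr 0}`, `W = {.r 0, .r 2, .sr 0}` (as a list). [folklore] -/
def dihedral13WitnessL : List (DihedralGroup 13 × DihedralGroup 13 × DihedralGroup 13) :=
  [(.r 0, .r 0, .r 0), (.r 0, .r 1, .r 2), (.r 0, .r 1, .sr 0), (.r 0, .sr 0, .r 2), (.r 1, .r 1, .r 0),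
    (.r 2, .r 0, .r 2), (.r 3, .r 1, .r 2), (.r 3, .sr 0, .r 2), (.r 3, .sr 0, .sr 0), (.r 4, .r 0, .sr 0),
    (.r 5, .r 0, .r 0), (.r 5, .r 1, .sr 0), (.r 6, .r 1, .r 0), (.r 6, .r 1, .sr 0), (.r 6, .sr 0, .sr 0),
    (.r 7, .r 0, .r 2), (.r 8, .r 1, .r 2), (.r 8, .sr 0, .r 2), (.r 9, .r 0, .sr 0), (.r 10, .r 0, .r 0),
    (.r 10, .r 1, .sr 0), (.r 11, .r 1, .r 0), (.r 11, .sr 0, .sr 0), (.r 12, .r 0, .r 2), (.r 12, .r 0, .sr 0),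
    (.sr 0, .r 0, .r 0), (.sr 0, .r 1, .r 2), (.sr 0, .r 1, .sr 0), (.sr 0, .sr 0, .r 2), (.sr 1, .r 0, .r 2),
    (.sr 1, .r 0, .sr 0), (.sr 2, .r 1, .r 0), (.sr 2, .sr 0, .sr 0), (.sr 3, .r 0, .r 0), (.sr 3, .r 1, .sr 0),
    (.sr 4, .r 0, .sr 0), (.sr 5, .r 1, .r 2), (.sr 5, .sr 0, .r 2), (.sr 6, .r 0, .r 2), (.sr 7, .r 1, .r 0),
    (.sr 7, .r 1, .sr 0), (.sr 7, .sr 0, .sr 0), (.sr 8, .r 0, .r 0), (.sr 8, .r 1, .sr 0), (.sr 9, .r 0, .sr 0),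
    (.sr 10, .r 1, .r 2), (.sr 10, .sr 0, .r 2), (.sr 10, .sr 0, .sr 0), (.sr 11, .r 0, .r 2), (.sr 12, .r 1, .r 0)]

set_option maxHeartbeats 4000000 in
/-- **`α(D₂₆; 26, 3, 3) ≥ 50`** (kernel-checked witness; `5·50 ≥ 9·26`). [folklore] -/
theorem dihedral13_exists_indep :
    ∃ (Y W : Finset (DihedralGroup 13)) (I : Finset (DihedralGroup 13 × DihedralGroup 13 × DihedralGroup 13)),
      #Y = 3 ∧ #W = 3 ∧ I ⊆ univ ×ˢ (Y ×ˢ W) ∧ (∀ P ∈ I, ∀ P' ∈ I, P ≠ P' → cellWord P P' ≠ 1) ∧ #I = 50 :=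
  ⟨{.r 0, .r 1, .sr 0}, {.r 0, .r 2, .sr 0}, dihedral13WitnessL.toFinset, by decide +kernel, by decide +kernel,
    DihC3Sq.subset_box_of_inBoxB (by decide +kernel), DihC3Sq.indep_of_indepB (by decide +kernel), by decide +kernel⟩

/-- **No finite group mapping onto `D₂₆` is box-useful.** [folklore] -/
theorem not_boxUseful_of_surjective_dihedral13 (f : G →* DihedralGroup 13) (hf : Function.Surjective f) : ¬ BoxUseful G := by
  obtain ⟨Y, W, I, hY, hW, hI, hind, hcard⟩ := dihedral13_exists_indep
  exact not_boxUseful_of_surjective f hf hY hW hI hind (by rw [hcard, DihedralGroup.card]; omega)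

/-- **No finite group containing `D₂₆` is box-useful.** [folklore] -/
theorem not_boxUseful_of_injective_dihedral13 (f : DihedralGroup 13 →* G) (hf : Function.Injective f) : ¬ BoxUseful G := by
  obtain ⟨Y, W, I, hY, hW, hI, hind, hcard⟩ := dihedral13_exists_indep
  exact not_boxUseful_of_injective f hf hY hW hI hind (by rw [hcard, DihedralGroup.card]; omega)

/-- **`D₂₆` is not box-useful.** [folklore] -/
theorem not_boxUseful_dihedral13 : ¬ BoxUseful (DihedralGroup 13) :=
  not_boxUseful_of_surjective_dihedral13 (MonoidHom.id _) Function.surjective_id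

/-! ### `QuaternionGroup 6` (`Dic₆`, order `24`): `44` independent cells `≥ (9/5)·24` -/

/-- The transported Pb67 witness of `QuaternionGroup 6`: `44` cells of the box `Y = {.a 0, .a 1, .xa 0}`, `W = {.a 0, .a 2, .xa 0}` (as a list). [folklore] -/
def quaternion6WitnessL : List (QuaternionGroup 6 × QuaternionGroup 6 × QuaternionGroup 6) :=
  [(.a 0, .a 1, .a 0), (.a 0, .a 1, .xa 0), (.a 0, .xa 0, .a 2), (.a 1, .a 0, .a 2), (.a 2, .a 1, .a 2),
    (.a 3, .a 0, .xa 0), (.a 3, .xa 0, .xa 0), (.a 4, .a 0, .xa 0), (.a 4, .a 1, .xa 0), (.a 5, .a 1, .xa 0),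
    (.a 6, .a 0, .a 0), (.a 6, .xa 0, .xa 0), (.a 7, .a 1, .a 0), (.a 7, .xa 0, .a 2), (.a 8, .a 0, .a 2),
    (.a 8, .a 0, .xa 0), (.a 9, .a 1, .a 2), (.a 9, .a 1, .xa 0), (.a 10, .xa 0, .xa 0), (.a 11, .a 0, .a 0),
    (.a 11, .a 0, .xa 0), (.a 11, .xa 0, .xa 0), (.xa 0, .a 0, .a 0), (.xa 0, .a 1, .xa 0), (.xa 0, .xa 0, .a 2),
    (.xa 0, .xa 0, .xa 0), (.xa 1, .a 0, .xa 0), (.xa 3, .a 1, .xa 0), (.xa 3, .xa 0, .xa 0), (.xa 4, .a 0, .xa 0),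
    (.xa 4, .a 1, .a 2), (.xa 5, .a 0, .a 2), (.xa 5, .xa 0, .a 2), (.xa 6, .a 1, .a 0), (.xa 7, .a 0, .a 0),
    (.xa 7, .a 1, .xa 0), (.xa 7, .xa 0, .xa 0), (.xa 8, .a 0, .xa 0), (.xa 8, .a 1, .xa 0), (.xa 8, .xa 0, .xa 0),
    (.xa 9, .a 0, .xa 0), (.xa 9, .a 1, .a 2), (.xa 10, .a 0, .a 2), (.xa 11, .a 1, .a 0)]

set_option maxHeartbeats 4000000 in
/-- **`α(Dic₆; 24, 3, 3) ≥ 44`** (kernel-checked witness; `5·44 ≥ 9·24`). [folklore] -/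
theorem quaternion6_exists_indep :
    ∃ (Y W : Finset (QuaternionGroup 6)) (I : Finset (QuaternionGroup 6 × QuaternionGroup 6 × QuaternionGroup 6)),
      #Y = 3 ∧ #W = 3 ∧ I ⊆ univ ×ˢ (Y ×ˢ W) ∧ (∀ P ∈ I, ∀ P' ∈ I, P ≠ P' → cellWord P P' ≠ 1) ∧ #I = 44 :=
  ⟨{.a 0, .a 1, .xa 0}, {.a 0, .a 2, .xa 0}, quaternion6WitnessL.toFinset, by decide +kernel, by decide +kernel,
    DihC3Sq.subset_box_of_inBoxB (by decide +kernel), DihC3Sq.indep_of_indepB (by decide +kernel), by decide +kernel⟩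

/-- **No finite group mapping onto `Dic₆` is box-useful.** [folklore] -/
theorem not_boxUseful_of_surjective_quaternion6 (f : G →* QuaternionGroup 6) (hf : Function.Surjective f) : ¬ BoxUseful G := by
  obtain ⟨Y, W, I, hY, hW, hI, hind, hcard⟩ := quaternion6_exists_indep
  exact not_boxUseful_of_surjective f hf hY hW hI hind (by rw [hcard, QuaternionGroup.card]; omega)

/-- **No finite group containing `Dic₆` is box-useful.** [folklore] -/
theorem not_boxUseful_of_injective_quaternion6 (f : QuaternionGroup 6 →* G) (hf : Function.Injective f) : ¬ BoxUseful G := by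
  obtain ⟨Y, W, I, hY, hW, hI, hind, hcard⟩ := quaternion6_exists_indep
  exact not_boxUseful_of_injective f hf hY hW hI hind (by rw [hcard, QuaternionGroup.card]; omega)

/-- **`Dic₆` is not box-useful.** [folklore] -/
theorem not_boxUseful_quaternion6 : ¬ BoxUseful (QuaternionGroup 6) :=
  not_boxUseful_of_surjective_quaternion6 (MonoidHom.id _) Function.surjective_id

end Summit.MatrixMultiplication.OmegaCensus
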